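import Summits.CriticalPhenomena.PercolationContinuityZ3.Theorems.Transplant.PlanarCells2SFar
import Summits.CriticalPhenomena.PercolationContinuityZ3.Theorems.Transplant.PlanarCells2ContainS
import HarnessLib

/-!
# STAGGERED two-unit planar cells `PCells2S`, (R-29)/J7: THE NARROW PROBE ARMS OF RECORD — the between-box shrunk ACROSS by the step's own creep,
# `BtwNS v δ := cenS v + {5r∥ < σ x_a < 15r∥} × [−(5r⊥ − 1 − c δ.1), 5r⊥ − 1 − c δ.1]`, and the unions built on it
# (`BtwNS₂`, `EwvNS := BtwNS ∪ Q (v+δ)`, `FarNS := BtwNS ∪ QNS v δ 1`, `FarNS₂ := BtwNS₂ ∪ QNS v δ 2`, `probeWorldNS`)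

WHY (J7, design owner p3-g15, lane INBOX 2026-08-22T21:38:59Z): under the stagger the unshrunk narrow between-boxes `PCells2S.BtwN` (PlanarCells2SDefs
:184) of two PERPENDICULAR probes into a common target overlap in a `(c₁−2) × (c₀−2)` corner (witness: `v = 0, δ = (0,+)` and `v′ = e₀ − e₁, δ′ = (1,+)`,
the site `(15r₀ − 2, −5r₁ + 2)` when `c₀, c₁ ≥ 3`), so the cover's field `SepGeom₂.Btw_disjoint_Btw` (spanned over the narrow boxes, SkelPhiCellsConcG
:299) would be false.  Shrinking the across half-width by the creep `c δ.1` of the step restores the disjointness of ALL pairs of arms other than the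
same / reversed edge (`PlanarCells2SepS.BtwNS_disjoint_BtwNS`), while the straight part of the K-G corridor (stubs, faces, E-run: across `± 2r⊥` about
`cenS v`) still fits (`2r⊥ ≤ 5r⊥ − 1 − c ⟸ c ≤ cmax ≤ r`), and the target's cube `M (v+δ) ⊆ QNS` ((R-27), p5-g15) is untouched.  The wide `Btw` is kept
for containments only.  J5 stands: `BtwNS` is not symmetric in the edge, the `rev` identities stay dropped.
This file: the definitions, their membership lemma, the monotone containments into the landed boxes (so every one-vertex fact is inherited), and the
containments the scheme reads (`Stub ⊆ Q ∪ BtwNS`, `BtwNS ⊆ Cell ∪ Cell′`, `Hfull ⊆ Q ∪ FarNS`, `M (v+δ) ⊆ FarNS₂ ⊆ FarNS ⊆ EwvNS`).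
builds on p205010 (kernel theorem, internal audit signed; external expert review pending) — nothing in this file uses p205010; nothing here is a
claim about the open node `SamePDropOfSkeletonFrm₁`.
Lane `prim-bschramm`, seat `prim-bschramm-p3` (gen 15; N2 design owner); definitions file (review lane), `--supports stmt-CriticalPhenomena-4575`.
[cite: KozmaNitzan2024, §4 pp. 25–26 (Q_v, E_{v,x}, H_{v,x}), p. 30]
-/

noncomputable section

namespace Summit.CriticalPhenomena.PercolationContinuityZ3.Theorems

namespace Transplant

open Literature.Probability.Percolation Literature.Probability.LatticeModels SimpleGraph GadgetSystem Contour
open Literature.Probability.Percolation.KozmaNitzan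
open Literature.Probability.Percolation.KozmaNitzan.Cells (oth oth_ne sgOf sgOf_sign stepVec_apply_fst stepVec_apply_oth eq_oth_of_ne oth_oth)
open PCells (mem_psBox_iff)

namespace PCells2S

variable (P : PCells2S)

/-! ## §1 Definitions -/

/-- **The narrow between-box of record** ((R-29)): `cenS v + {5r∥ < σ x_a < 15r∥} × [−(5r⊥ − 1 − c δ.1), 5r⊥ − 1 − c δ.1]` — `BtwN` shrunk across by the
creep of the step `δ`. [cite: KozmaNitzan2024, §4 p. 26 (E_{v,x})] -/
def BtwNS (v : Site 2) (δ : MDir) : Finset (Site 2) :=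
  sBox δ.1 (sgOf δ) (P.cenS v) (5 * P.r δ.1 + 1) (15 * P.r δ.1 - 1) (5 * (P.r (oth δ.1) : ℤ) - 1 - P.c δ.1)

/-- The twice-narrowed between-box of record: across half-width `5r⊥ − 2 − c δ.1`. [cite: KozmaNitzan2024, §4 p. 26 (E_{v,x})] -/
def BtwNS₂ (v : Site 2) (δ : MDir) : Finset (Site 2) :=
  sBox δ.1 (sgOf δ) (P.cenS v) (5 * P.r δ.1 + 1) (15 * P.r δ.1 - 1) (5 * (P.r (oth δ.1) : ℤ) - 2 - P.c δ.1)

/-- The narrow `E_{v,x}` of record: `BtwNS ∪ Q_x` (the target's cube about the staggered neighbour centre). [cite: KozmaNitzan2024, §4 p. 26 (E_{v,x})] -/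
def EwvNS (v : Site 2) (δ : MDir) : Finset (Site 2) := P.BtwNS v δ ∪ P.Q (v + stepVec δ)

/-- **The narrow far region of record** ((R-27) + (R-29)): `BtwNS ∪ QNS v δ 1` — between-box of record and the neighbour's box narrowed by one across.
[cite: KozmaNitzan2024, §4 p. 26 (E^far_{v,x})] -/
def FarNS (v : Site 2) (δ : MDir) : Finset (Site 2) := P.BtwNS v δ ∪ P.QNS v δ 1

/-- The twice-narrowed far region of record: `BtwNS₂ ∪ QNS v δ 2`. [cite: KozmaNitzan2024, §4 p. 26 (E^far_{v,x})] -/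
def FarNS₂ (v : Site 2) (δ : MDir) : Finset (Site 2) := P.BtwNS₂ v δ ∪ P.QNS v δ 2

/-- The narrow planar world of the probe `v → v+δ → v+δ+du` of record: `BtwNS v δ ∪ Q (v+δ) ∪ Hfull (v+δ) du`. [cite: KozmaNitzan2024, §4 p. 26 (E_{v,x}, H_{x,y})] -/
def probeWorldNS (v : Site 2) (δ du : MDir) : Finset (Site 2) := P.BtwNS v δ ∪ P.Q (v + stepVec δ) ∪ P.Hfull (v + stepVec δ) du

/-! ## §2 Membership and the creep bounds -/

variable {P} in
/-- Membership in `BtwNS`. [folklore] -/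
theorem mem_BtwNS_iff {v : Site 2} {δ : MDir} {t : Site 2} :
    t ∈ P.BtwNS v δ ↔
      (5 * (P.r δ.1 : ℤ) + 1 ≤ sgOf δ * (t δ.1 - P.cenS v δ.1) ∧ sgOf δ * (t δ.1 - P.cenS v δ.1) ≤ 15 * (P.r δ.1 : ℤ) - 1) ∧
      (P.cenS v (oth δ.1) - (5 * (P.r (oth δ.1) : ℤ) - 1 - P.c δ.1) ≤ t (oth δ.1) ∧
        t (oth δ.1) ≤ P.cenS v (oth δ.1) + (5 * (P.r (oth δ.1) : ℤ) - 1 - P.c δ.1)) := by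
  rw [BtwNS, mem_psBox_iff]

variable {P} in
/-- Membership in `BtwNS₂`. [folklore] -/
theorem mem_BtwNS₂_iff {v : Site 2} {δ : MDir} {t : Site 2} :
    t ∈ P.BtwNS₂ v δ ↔
      (5 * (P.r δ.1 : ℤ) + 1 ≤ sgOf δ * (t δ.1 - P.cenS v δ.1) ∧ sgOf δ * (t δ.1 - P.cenS v δ.1) ≤ 15 * (P.r δ.1 : ℤ) - 1) ∧
      (P.cenS v (oth δ.1) - (5 * (P.r (oth δ.1) : ℤ) - 2 - P.c δ.1) ≤ t (oth δ.1) ∧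
        t (oth δ.1) ≤ P.cenS v (oth δ.1) + (5 * (P.r (oth δ.1) : ℤ) - 2 - P.c δ.1)) := by
  rw [BtwNS₂, mem_psBox_iff]

/-- `0 ≤ c i`. [folklore] -/
theorem c_nonneg (i : Fin 2) : 0 ≤ P.c i := P.hc0 i

/-- `c δ.1 ≤ r (oth δ.1)`: the creep of a step is at most the across unit. [folklore] -/
theorem c_le_r_oth (δ : MDir) : P.c δ.1 ≤ (P.r (oth δ.1) : ℤ) := (P.hcm δ.1).trans (by exact_mod_cast P.hcr (oth δ.1))

/-- `c i ≤ r j` for all `i, j`. [folklore] -/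
theorem c_le_r (i j : Fin 2) : P.c i ≤ (P.r j : ℤ) := (P.hcm i).trans (by exact_mod_cast P.hcr j)

/-! ## §3 Monotone containments into the landed boxes (every one-vertex fact is inherited) -/

/-- `BtwNS ⊆ BtwN`. [folklore] -/
theorem BtwNS_subset_BtwN (v : Site 2) (δ : MDir) : PCells2S.BtwNS P v δ ⊆ PCells2S.BtwN P v δ := by
  intro t ht
  rw [mem_BtwNS_iff] at ht
  rw [BtwN, mem_psBox_iff]
  have hc := P.c_nonneg δ.1
  obtain ⟨h12, h3, h4⟩ := ht
  exact ⟨h12, by omega, by omega⟩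

/-- `BtwNS ⊆ Btw`. [folklore] -/
theorem BtwNS_subset_Btw (v : Site 2) (δ : MDir) : PCells2S.BtwNS P v δ ⊆ PCells2S.Btw P v δ :=
  (P.BtwNS_subset_BtwN v δ).trans (P.BtwN_subset_Btw v δ)

/-- `BtwNS₂ ⊆ BtwNS`. [folklore] -/
theorem BtwNS₂_subset_BtwNS (v : Site 2) (δ : MDir) : PCells2S.BtwNS₂ P v δ ⊆ PCells2S.BtwNS P v δ := by
  intro t ht
  rw [mem_BtwNS₂_iff] at ht
  rw [mem_BtwNS_iff]
  obtain ⟨h12, h3, h4⟩ := ht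
  exact ⟨h12, by omega, by omega⟩

/-- `BtwNS₂ ⊆ BtwN₂` (p5-g15's unshrunk twice-narrowed box). [folklore] -/
theorem BtwNS₂_subset_BtwN₂ (v : Site 2) (δ : MDir) : PCells2S.BtwNS₂ P v δ ⊆ PCells2S.BtwN₂ P v δ := by
  intro t ht
  rw [mem_BtwNS₂_iff] at ht
  rw [BtwN₂, mem_psBox_iff]
  have hc := P.c_nonneg δ.1
  obtain ⟨h12, h3, h4⟩ := ht
  exact ⟨h12, by omega, by omega⟩

/-- `EwvNS ⊆ EwvN`. [folklore] -/
theorem EwvNS_subset_EwvN (v : Site 2) (δ : MDir) : PCells2S.EwvNS P v δ ⊆ PCells2S.EwvN P v δ :=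
  Finset.union_subset_union (P.BtwNS_subset_BtwN v δ) subset_rfl

/-- `EwvNS ⊆ Ewv`. [folklore] -/
theorem EwvNS_subset_Ewv (v : Site 2) (δ : MDir) : PCells2S.EwvNS P v δ ⊆ PCells2S.Ewv P v δ :=
  Finset.union_subset_union (P.BtwNS_subset_Btw v δ) subset_rfl

/-- `FarNS ⊆ EfarNS` (p5-g15's (R-27) far region over the unshrunk box). [folklore] -/
theorem FarNS_subset_EfarNS (v : Site 2) (δ : MDir) : PCells2S.FarNS P v δ ⊆ PCells2S.EfarNS P v δ :=
  Finset.union_subset_union (P.BtwNS_subset_BtwN v δ) subset_rfl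

/-- `FarNS ⊆ EwvNS` (`QNS v δ 1 ⊆ Q (v+δ)`). [folklore] -/
theorem FarNS_subset_EwvNS (v : Site 2) (δ : MDir) : PCells2S.FarNS P v δ ⊆ PCells2S.EwvNS P v δ :=
  Finset.union_subset_union subset_rfl (QNS_subset_Q v δ 1)

/-- `FarNS ⊆ EfarS = Btw ∪ Q (v+δ)`. [folklore] -/
theorem FarNS_subset_EfarS (v : Site 2) (δ : MDir) : PCells2S.FarNS P v δ ⊆ PCells2S.EfarS P v δ :=
  (P.FarNS_subset_EfarNS v δ).trans (P.EfarNS_subset_EfarS v δ)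

/-- `FarNS₂ ⊆ FarNS`. [folklore] -/
theorem FarNS₂_subset_FarNS (v : Site 2) (δ : MDir) : PCells2S.FarNS₂ P v δ ⊆ PCells2S.FarNS P v δ :=
  Finset.union_subset_union (P.BtwNS₂_subset_BtwNS v δ) (QNS_mono v δ (by norm_num))

/-- `FarNS₂ ⊆ EfarN₂S` (p5-g15's). [folklore] -/
theorem FarNS₂_subset_EfarN₂S (v : Site 2) (δ : MDir) : PCells2S.FarNS₂ P v δ ⊆ PCells2S.EfarN₂S P v δ :=
  Finset.union_subset_union (P.BtwNS₂_subset_BtwN₂ v δ) subset_rfl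

/-- `BtwNS ⊆ FarNS`. [folklore] -/
theorem BtwNS_subset_FarNS (v : Site 2) (δ : MDir) : PCells2S.BtwNS P v δ ⊆ PCells2S.FarNS P v δ := Finset.subset_union_left

/-- `QNS v δ 1 ⊆ FarNS`. [folklore] -/
theorem QNS_one_subset_FarNS (v : Site 2) (δ : MDir) : PCells2S.QNS P v δ 1 ⊆ PCells2S.FarNS P v δ := Finset.subset_union_right

/-- `probeWorldNS ⊆ probeWorldN`. [folklore] -/
theorem probeWorldNS_subset_probeWorldN (v : Site 2) (δ du : MDir) : PCells2S.probeWorldNS P v δ du ⊆ PCells2S.probeWorldN P v δ du :=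
  Finset.union_subset_union (Finset.union_subset_union (P.BtwNS_subset_BtwN v δ) subset_rfl) subset_rfl

/-- `EwvNS ⊆ probeWorldNS`. [folklore] -/
theorem EwvNS_subset_probeWorldNS (v : Site 2) (δ du : MDir) : PCells2S.EwvNS P v δ ⊆ PCells2S.probeWorldNS P v δ du := Finset.subset_union_left

/-- `BtwNS ⊆ Cell v ∪ Cell (v+δ)`. [folklore] -/
theorem BtwNS_subset_Cells (v : Site 2) (δ : MDir) : PCells2S.BtwNS P v δ ⊆ PCells2S.Cell P v ∪ PCells2S.Cell P (v + stepVec δ) :=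
  (P.BtwNS_subset_Btw v δ).trans (P.Btw_subset_Cells v δ)

/-! ## §4 The containments the scheme reads -/

/-- **`H^j ⊆ Q_v ∪ BtwNS`** for `j + 1 ≤ K`: the straight stub (across `± 2r⊥` about `cenS v`) fits the shrunk box since `2r⊥ + c + 1 ≤ 5r⊥` (`c ≤ r⊥`).
[cite: KozmaNitzan2024, §4 p. 26 (H^j ⊆ Q ∪ E)] -/
theorem Stub_subset_Q_union_BtwNS (v : Site 2) (δ : MDir) {j : ℕ} (hj : j < P.K) :
    (PCells2S.Stub P v δ j : Finset (Site 2)) ⊆ PCells2S.Q P v ∪ PCells2S.BtwNS P v δ := by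
  intro t ht
  rw [Stub, mem_psBox_iff] at ht
  obtain ⟨⟨h1, h2⟩, h3, h4⟩ := ht
  have hsj := PCells2.ten_s_mul_le_of_lt P.toPCells2 (a := δ.1) hj
  have hs1 := P.hs δ.1
  have hr1 := P.one_le_r (oth δ.1)
  have hc := P.c_nonneg δ.1
  have hc' := P.c_le_r_oth δ
  rw [Finset.mem_union, Q, mem_aboxS_iff, mem_BtwNS_iff]
  by_cases hlev : sgOf δ * (t δ.1 - P.cenS v δ.1) ≤ 5 * P.r δ.1
  · left
    intro i
    rcases eq_or_ne i δ.1 with rfl | hi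
    · rcases sgOf_sign δ with hs | hs <;> rw [hs] at h1 hlev <;> push_cast <;> constructor <;> omega
    · rw [eq_oth_of_ne hi]; push_cast; constructor <;> omega
  · right
    refine ⟨⟨by omega, by omega⟩, by omega, by omega⟩

/-- **The full corridor lies in `Q_v ∪ FarNS`**: levels `≤ 5r∥` in `Q v`, `(5r∥, 15r∥)` in `BtwNS` (`2r⊥ ≤ 5r⊥ − 1 − c`), `[15r∥, 22r∥]` in `QNS v δ 1`
(across `|t − cenS v − σc| ≤ 2r⊥ + c ≤ 5r⊥ − 1`). [cite: KozmaNitzan2024, §4 p. 26 (H_{v,x} ⊆ Q ∪ E^far)] -/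
theorem Hfull_subset_Q_union_FarNS (v : Site 2) (δ : MDir) : (PCells2S.Hfull P v δ : Finset (Site 2)) ⊆ PCells2S.Q P v ∪ PCells2S.FarNS P v δ := by
  intro t ht
  rw [Hfull, mem_psBox_iff] at ht
  obtain ⟨⟨h1, h2⟩, h3, h4⟩ := ht
  have hr1 := P.one_le_r (oth δ.1)
  have hc := P.c_nonneg δ.1
  have hc' := P.c_le_r_oth δ
  have hg := P.sg_c_bound δ
  have hf := P.cenS_add_stepVec_fst v δ
  have ho := P.cenS_add_stepVec_oth v δ
  rw [Finset.mem_union, Q, mem_aboxS_iff, FarNS, Finset.mem_union, mem_BtwNS_iff, mem_QNS_iff, hf, ho]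
  by_cases hlev : sgOf δ * (t δ.1 - P.cenS v δ.1) ≤ 5 * P.r δ.1
  · left
    intro i
    rcases eq_or_ne i δ.1 with rfl | hi
    · rcases sgOf_sign δ with hs | hs <;> rw [hs] at h1 hlev <;> push_cast <;> constructor <;> omega
    · rw [eq_oth_of_ne hi]; push_cast; constructor <;> omega
  · right
    by_cases hlev' : sgOf δ * (t δ.1 - P.cenS v δ.1) ≤ 15 * P.r δ.1 - 1
    · left
      exact ⟨⟨by omega, hlev'⟩, by omega, by omega⟩
    · right
      push_cast
      refine ⟨?_, by omega, by omega⟩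
      rcases sgOf_sign δ with hs | hs <;> rw [hs] at h1 h2 hlev hlev' ⊢ <;> constructor <;> nlinarith

/-- **The target's cube lies in `FarNS₂`** (`M (v+δ) ⊆ QNS v δ 2`, p5-g15). [cite: KozmaNitzan2024, §4 p. 26 (M_x ⊆ E^far)] -/
theorem M_add_stepVec_subset_FarNS₂ (v : Site 2) (δ : MDir) : PCells2S.M P (v + stepVec δ) ⊆ PCells2S.FarNS₂ P v δ := by
  refine (Finset.subset_union_right.trans' (M_add_stepVec_subset_QNS v δ ?_))
  have := P.one_le_r (oth δ.1)
  push_cast; omega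

/-- `M (v+δ) ⊆ FarNS`. [folklore] -/
theorem M_add_stepVec_subset_FarNS (v : Site 2) (δ : MDir) : PCells2S.M P (v + stepVec δ) ⊆ PCells2S.FarNS P v δ :=
  (P.M_add_stepVec_subset_FarNS₂ v δ).trans (P.FarNS₂_subset_FarNS v δ)

/-- `M (v+δ) ⊆ EwvNS`. [folklore] -/
theorem M_add_stepVec_subset_EwvNS (v : Site 2) (δ : MDir) : PCells2S.M P (v + stepVec δ) ⊆ PCells2S.EwvNS P v δ :=
  (P.M_add_stepVec_subset_FarNS v δ).trans (P.FarNS_subset_EwvNS v δ)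

/-- `Stub ⊆ Q ∪ FarNS` for `j + 1 ≤ K`. [folklore] -/
theorem Stub_subset_Q_union_FarNS (v : Site 2) (δ : MDir) {j : ℕ} (hj : j < P.K) :
    (PCells2S.Stub P v δ j : Finset (Site 2)) ⊆ PCells2S.Q P v ∪ PCells2S.FarNS P v δ :=
  (P.Stub_subset_Q_union_BtwNS v δ hj).trans (Finset.union_subset_union subset_rfl (P.BtwNS_subset_FarNS v δ))

/-- `Stub ⊆ probeWorldNS (v) δ du`-shaped containment at the SOURCE: `Stub v δ j ⊆ Q v ∪ EwvNS v δ`. [folklore] -/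
theorem Stub_subset_Q_union_EwvNS (v : Site 2) (δ : MDir) {j : ℕ} (hj : j < P.K) :
    (PCells2S.Stub P v δ j : Finset (Site 2)) ⊆ PCells2S.Q P v ∪ PCells2S.EwvNS P v δ :=
  (P.Stub_subset_Q_union_BtwNS v δ hj).trans (Finset.union_subset_union subset_rfl Finset.subset_union_left)

end PCells2S

end Transplant

end Summit.CriticalPhenomena.PercolationContinuityZ3.Theorems

end
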